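import Summits.NavierStokesRegularity.FluidComputer.AnisotropyFace
import Literature.Analysis.FluidPDE.MillerMiddleEigenvalueSupPropagation
import Literature.Analysis.FluidPDE.AncientLPSLiouvilleProofs
import HarnessLib

/-!
# Fluid computer — the level dictionary, STRAIN FACE, THE ENDPOINT (L41″): `∫ sup_x λ₂⁺ dt = ∞` on every
# terminal window (Neustupa–Penel / Miller, `q = ∞`)

HONEST FRAMING (cell `pub-fluidc`, verbatim): *low prior, high value-of-information experiment on Tao's
machine paradigm; NOT a claim that NS blows up.* Theorem side of the cell; nothing here is evidence of blow-up.
`StrainFace` (L41) gives `‖λ₂⁺‖_{L^p_tL^q_x} = ∞` for `2/p + 3/q = 2`, `3/2 < q < ∞`, and records the endpoint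
`q = ∞` — `∫₀ᵀ sup_x λ₂⁺ dt = ∞`, the Beale–Kato–Majda analogue for the middle eigenvalue of the strain — as
missing from the tree's discharge of Miller's mixed-norm theorem. It is in fact PROVED in the tree in propagation
form: `limsup_eH1NormSq_lt_top_of_midStrain_sup` (Miller 2019, Thm. 1.1 with `q = ∞`: the enstrophy grows at most
like `exp(4∫ m)` under a time-only majorant `m(t) ≥ sup_x λ₂⁺(t, x)`). Read on the class through Leray's `H¹`
continuation and the tool `AnisotropyFace.not_isH1RegularOn_Ioc` (the L19 clock), for every maximal smooth solution
`(u, p)` of the unforced Navier–Stokes system on `ℝ³ × [0, T)` (`ν > 0`), Leray–Hopf from `u 0`, and every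
nonnegative TIME-ONLY Courant–Fischer majorant `m` of the middle strain eigenvalue (at each `(t, x)` an orthonormal
pair `v, w` with `⟪∇u(t,x)ξ, ξ⟫ ≤ m(t)|ξ|²` on `span{v, w}` — e.g. `m(t) = sup_x λ₂⁺(t, x)` when finite):

* `strain_sup_lintegral_eq_top` (**L41″**): `∫_{(0,T)} m(t) dt = ∞`;
* `strain_sup_lintegral_window_eq_top`: `∫_{(t₀,T)} m = ∞` for every `t₀ ∈ [0, T)` (restart at an a.e.-good time);
* `strain_sup_face`: assembled.

Reading for the machine paradigm (words): the BKM row of the strain — the running integral of the spatial maximum of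
the SHEET-FORMING strain rate `λ₂⁺` must diverge on every terminal window, exactly as `∫‖ω‖_∞` must (L31); in the
mean `sup_x λ₂⁺(t) ≳ (T − t)^{−1}`. A machine whose maximal middle strain rate stays integrable does not blow up.
No constants. Necessity only. 0 sorry; no new definitions, no named facts.

## References

* E. Miller, Arch. Ration. Mech. Anal. 237 (2020) 1237–1263, Thm. 1.1 (`q = ∞`). [Miller2019]
* J. Neustupa, P. Penel, in *Mathematical Fluid Mechanics*, Birkhäuser 2001, 237–265. [NeustupaPenel2001]
* J. T. Beale, T. Kato, A. Majda, Comm. Math. Phys. 94 (1984) 61–66. [BealeKatoMajda1984]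
-/

noncomputable section

open MeasureTheory Set Function Filter Topology Metric InnerProductSpace
open scoped ENNReal NNReal RealInnerProductSpace
open Literature.Analysis.FluidPDE Literature.Analysis.FunctionSpaces
open Summit.NavierStokesRegularity.FluidComputer.AnisotropyFace

namespace Summit.NavierStokesRegularity.FluidComputer.StrainSupFace

/-- **L41″ — `∫₀ᵀ sup_x λ₂⁺ dt = ∞` (the `q = ∞` endpoint of the strain face).** For `ν > 0`, `T > 0`, every maximal
smooth solution `(u, p)` of the unforced Navier–Stokes system on `ℝ³ × [0, T)` which is Leray–Hopf from `u 0`, and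
every nonnegative time-only Courant–Fischer majorant `m` of the middle eigenvalue of the strain on `[0, T) × ℝ³`:
`∫_{(0,T)} m(t) dt = ∞`. Otherwise Miller's propagation estimate (`limsup_eH1NormSq_lt_top_of_midStrain_sup`, PROVED
in the tree) and Leray's continuation (`leray_continuation_H1_holds`) make `u` `H¹`-regular on `(0, T]`, against
`not_isH1RegularOn_Ioc`. [cite: Miller2019, Thm 1.1] [cite: NeustupaPenel2001, Thm 2] -/
theorem strain_sup_lintegral_eq_top {ν T : ℝ} (hν : 0 < ν) (hT : 0 < T)
    {u : ℝ → EuclideanSpace ℝ (Fin 3) → EuclideanSpace ℝ (Fin 3)} {p : ℝ → EuclideanSpace ℝ (Fin 3) → ℝ}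
    (hmax : IsMaximalSmoothSolution ν 0 u p T) (hLH : IsLerayHopfOn T ν 0 (u 0) u)
    {m : ℝ → ℝ} (hm0 : ∀ t, 0 ≤ m t)
    (hmaj : ∀ t ∈ Ico 0 T, ∀ x, ∃ v w : EuclideanSpace ℝ (Fin 3), ‖v‖ = 1 ∧ ‖w‖ = 1 ∧
      inner ℝ v w = 0 ∧ ∀ α β : ℝ,
        inner ℝ (fderiv ℝ (u t) x (α • v + β • w)) (α • v + β • w) ≤ m t * (α ^ 2 + β ^ 2)) :
    ∫⁻ t in Ioo 0 T, ENNReal.ofReal (m t) = ⊤ := by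
  by_contra hfin
  obtain ⟨c, hc, hL2⟩ := tao2011_H1_local_almost_regular_holds
  have hA : ∀ b < T, ∫⁻ t in Ioo 0 b, ENNReal.ofReal (m t) ≠ ⊤ := fun b hb =>
    ne_top_of_le_ne_top hfin (lintegral_mono_set (Ioo_subset_Ioo_right hb.le))
  refine not_isH1RegularOn_Ioc hν hT hmax hLH
    (leray_continuation_H1_holds ν T hν hT (u 0) u hLH fun α β hα hαβ hβ hregI => ?_)
  have hAβ : ∫⁻ t in Ioo 0 β, ENNReal.ofReal (m t) ≠ ⊤ :=
    ne_top_of_le_ne_top hfin (lintegral_mono_set (Ioo_subset_Ioo_right hβ))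
  exact limsup_eH1NormSq_lt_top_of_midStrain_sup hL2 hc hν hLH hmax.1 hm0 hmaj hA hα hαβ hβ hAβ hregI

/-- **L41″ ON EVERY TERMINAL WINDOW**: for every `t₀ ∈ [0, T)`, `∫_{(t₀,T)} m(t) dt = ∞` (restart at an a.e.-good
time `s ∈ (t₀, T)`; the translate is a maximal smooth Leray–Hopf solution with the majorant `m(· + s)`; translate
the time integral back with `lintegral_Ioo_comp_add_right`). [cite: Miller2019, Thm 1.1] -/
theorem strain_sup_lintegral_window_eq_top {ν T : ℝ} (hν : 0 < ν)
    {u : ℝ → EuclideanSpace ℝ (Fin 3) → EuclideanSpace ℝ (Fin 3)} {p : ℝ → EuclideanSpace ℝ (Fin 3) → ℝ}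
    (hmax : IsMaximalSmoothSolution ν 0 u p T) (hLH : IsLerayHopfOn T ν 0 (u 0) u)
    {m : ℝ → ℝ} (hm0 : ∀ t, 0 ≤ m t)
    (hmaj : ∀ t ∈ Ico 0 T, ∀ x, ∃ v w : EuclideanSpace ℝ (Fin 3), ‖v‖ = 1 ∧ ‖w‖ = 1 ∧
      inner ℝ v w = 0 ∧ ∀ α β : ℝ,
        inner ℝ (fderiv ℝ (u t) x (α • v + β • w)) (α • v + β • w) ≤ m t * (α ^ 2 + β ^ 2))
    {t₀ : ℝ} (ht₀ : t₀ ∈ Ico 0 T) :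
    ∫⁻ t in Ioo t₀ T, ENNReal.ofReal (m t) = ⊤ := by
  obtain ⟨s, hs, hLHs⟩ := hLH.exists_isLerayHopfOn_restart_Ioo hν.le ht₀.1 ht₀.2 le_rfl
  have hs0 : 0 < s := ht₀.1.trans_lt hs.1
  have hTs : 0 < T - s := sub_pos.2 hs.2
  have hmax' : IsMaximalSmoothSolution ν 0 (fun t => u (t + s)) (fun t => p (t + s)) (T - s) :=
    hmax.translate_zero hs0 hs.2
  have hLH' : IsLerayHopfOn (T - s) ν 0 ((fun t => u (t + s)) 0) (fun t => u (t + s)) := by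
    show IsLerayHopfOn (T - s) ν 0 (u (0 + s)) (fun t => u (t + s))
    rw [zero_add]
    exact hLHs
  have hmaj' : ∀ t ∈ Ico 0 (T - s), ∀ x, ∃ v w : EuclideanSpace ℝ (Fin 3), ‖v‖ = 1 ∧ ‖w‖ = 1 ∧
      inner ℝ v w = 0 ∧ ∀ α β : ℝ,
        inner ℝ (fderiv ℝ ((fun t => u (t + s)) t) x (α • v + β • w)) (α • v + β • w) ≤
          m (t + s) * (α ^ 2 + β ^ 2) :=
    fun t ht x => hmaj (t + s) ⟨by linarith [ht.1, hs0], by linarith [ht.2]⟩ x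
  have key := strain_sup_lintegral_eq_top hν hTs hmax' hLH' (m := fun t => m (t + s)) (fun t => hm0 _) hmaj'
  set F : ℝ → ℝ≥0∞ := fun t => ENNReal.ofReal (m t) with hF
  have hshift : ∫⁻ t in Ioo 0 (T - s), F (t + s) = ∫⁻ t in Ioo s T, F t := by
    rw [lintegral_Ioo_comp_add_right F s (T - s), add_sub_cancel]
  have hmono : ∫⁻ t in Ioo s T, F t ≤ ∫⁻ t in Ioo t₀ T, F t :=
    lintegral_mono_set (Ioo_subset_Ioo_left hs.1.le)
  have hkey' : ∫⁻ t in Ioo 0 (T - s), F (t + s) = ⊤ := key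
  rw [hshift] at hkey'
  exact eq_top_iff.2 (hkey' ▸ hmono)

/-- **THE STRAIN ENDPOINT, ASSEMBLED**: on every terminal window the time integral of every nonnegative time-only
Courant–Fischer majorant of the middle strain eigenvalue (e.g. `sup_x λ₂⁺`) diverges. [cite: Miller2019, Thm 1.1] -/
theorem strain_sup_face {ν T : ℝ} (hν : 0 < ν)
    {u : ℝ → EuclideanSpace ℝ (Fin 3) → EuclideanSpace ℝ (Fin 3)} {p : ℝ → EuclideanSpace ℝ (Fin 3) → ℝ}
    (hmax : IsMaximalSmoothSolution ν 0 u p T) (hLH : IsLerayHopfOn T ν 0 (u 0) u) :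
    ∀ m : ℝ → ℝ, (∀ t, 0 ≤ m t) →
      (∀ t ∈ Ico 0 T, ∀ x, ∃ v w : EuclideanSpace ℝ (Fin 3), ‖v‖ = 1 ∧ ‖w‖ = 1 ∧
        inner ℝ v w = 0 ∧ ∀ α β : ℝ,
          inner ℝ (fderiv ℝ (u t) x (α • v + β • w)) (α • v + β • w) ≤ m t * (α ^ 2 + β ^ 2)) →
      ∀ t₀ ∈ Ico 0 T, ∫⁻ t in Ioo t₀ T, ENNReal.ofReal (m t) = ⊤ :=
  fun _ hm0 hmaj _ ht₀ => strain_sup_lintegral_window_eq_top hν hmax hLH hm0 hmaj ht₀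

end Summit.NavierStokesRegularity.FluidComputer.StrainSupFace

end
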